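import Mathlib
import Summits.CriticalPhenomena.PercolationContinuityZ3.Theorems.PercNearOneGluingNoHeavyLowerTailOrientedAntipodalHall

/-!
# Reversing all types: Theorem O for a type class transfers to the reversed class

Helper file for crux `stmt-CriticalPhenomena-4575` (`NoHeavyLowerTail`, route `PercNearOneGluingNoHeavy`),
new-inequality factory seat `prim-ineq-gen-3` (gen 13).  Everything here is PROVED.

The DUAL labeling `f⋆ U := (f (S \ U))ᵒᵖ` (swap `A ↔ B`, petals fixed) of a monotone `f : Finset α → Lab k` is monotone,
has the SAME good sets inside `S`, and a bad `X ⊆ S` of type `(p, q)` for `f` is a bad of type `(q, p)` for `f⋆`.  Hence an SDR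
statement proved for the reversed type class applies to the original one (`exists_injective_good_above_of_reverse`).
Nineteen of the census instances in `…OrientedAntipodalHallFiveCertA/B/C` are stated for the reversed representative of
their class; with this lemma (and `…Relabel` for petal permutations) every one of the 578 certified five-petal classes is
covered in any orientation and on any number of petals.  (prim-ineq-gen-3 gen 13, 2026-08-21.)
-/

namespace Summit.CriticalPhenomena.PercolationContinuityZ3.Theorems

namespace OrientedAntipodalHall

open Finset AntipodalStrongHarris AntipodalStrongHarris.Lab
open scoped FinsetFamily

variable {α : Type*} [DecidableEq α] {k : ℕ}

/-- **Reversing the types.**  Let `f` be monotone into `Lab k` and `D` a family of bads of `S` (`f X = C_{i X}`,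
`f (S \ X) = C_{j X}`).  If the SDR conclusion of Theorem O holds for EVERY monotone labeling `f'` with the same good subsets
of `S` as `f` under which every `X ∈ D` is a bad of the REVERSED type `(j X, i X)`, then it holds for `f`.  (Apply it to the
dual labeling `U ↦ (f (S \ U))ᵒᵖ`.) -/
theorem exists_injective_good_above_of_reverse (S : Finset α) {f : Finset α → Lab k}
    (hf : ∀ ⦃X Y : Finset α⦄, X ⊆ Y → f X ≤ f Y) (D : Finset (Finset α)) (i j : Finset α → Fin k)
    (hDS : ∀ X ∈ D, X ⊆ S) (hDi : ∀ X ∈ D, f X = petal (i X)) (hDj : ∀ X ∈ D, f (S \ X) = petal (j X))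
    (H : ∀ f' : Finset α → Lab k, (∀ ⦃X Y : Finset α⦄, X ⊆ Y → f' X ≤ f' Y) →
      (∀ X ∈ D, f' X = petal (j X)) → (∀ X ∈ D, f' (S \ X) = petal (i X)) →
      (∀ U ⊆ S, (f' U = top ∧ f' (S \ U) = bot) ↔ (f U = top ∧ f (S \ U) = bot)) →
      ∃ φ : D → Finset α, Function.Injective φ ∧
        ∀ X : D, (X : Finset α) ⊆ φ X ∧ φ X ⊆ S ∧ f' (φ X) = top ∧ f' (S \ φ X) = bot) :
    ∃ φ : D → Finset α, Function.Injective φ ∧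
      ∀ X : D, (X : Finset α) ⊆ φ X ∧ φ X ⊆ S ∧ f (φ X) = top ∧ f (S \ φ X) = bot := by
  -- the order-reversing involution of `Lab k`
  let op : Lab k → Lab k := fun c => match c with
    | bot => top
    | petal p => petal p
    | top => bot
  have hop_anti : ∀ c d : Lab k, c ≤ d → op d ≤ op c := by
    intro c d hcd
    rw [le_def] at hcd ⊢
    rcases hcd with h | h | h
    · right; left; rw [h]
    · left; rw [h]
    · right; right; rw [h]
  have hop_top : ∀ c : Lab k, op c = top ↔ c = bot := by
    intro c; rcases c with _ | p | _ <;> simp [op]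
  have hop_bot : ∀ c : Lab k, op c = bot ↔ c = top := by
    intro c; rcases c with _ | p | _ <;> simp [op]
  have hop_petal : ∀ (c : Lab k) (p : Fin k), c = petal p → op c = petal p := by
    intro c p h; rw [h]
  -- the dual labeling
  let f' : Finset α → Lab k := fun U => op (f (S \ U))
  have hf' : ∀ ⦃X Y : Finset α⦄, X ⊆ Y → f' X ≤ f' Y :=
    fun X Y hXY => hop_anti _ _ (hf (sdiff_subset_sdiff (le_refl S) hXY))
  have hDi' : ∀ X ∈ D, f' X = petal (j X) := fun X hX => hop_petal _ _ (hDj X hX)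
  have hDj' : ∀ X ∈ D, f' (S \ X) = petal (i X) := by
    intro X hX
    show op (f (S \ (S \ X))) = _
    rw [Finset.sdiff_sdiff_eq_self (hDS X hX)]
    exact hop_petal _ _ (hDi X hX)
  have hgood : ∀ U ⊆ S, (f' U = top ∧ f' (S \ U) = bot) ↔ (f U = top ∧ f (S \ U) = bot) := by
    intro U hUS
    show (op (f (S \ U)) = top ∧ op (f (S \ (S \ U))) = bot) ↔ _
    rw [Finset.sdiff_sdiff_eq_self hUS, hop_top, hop_bot]
    exact and_comm
  obtain ⟨φ, hφinj, hφ⟩ := H f' hf' hDi' hDj' hgood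
  refine ⟨φ, hφinj, fun X => ?_⟩
  obtain ⟨h1, h2, h3, h4⟩ := hφ X
  obtain ⟨h5, h6⟩ := (hgood (φ X) h2).mp ⟨h3, h4⟩
  exact ⟨h1, h2, h5, h6⟩

end OrientedAntipodalHall

end Summit.CriticalPhenomena.PercolationContinuityZ3.Theorems
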